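import Mathlib
import Summits.HubbardSuperconductivity.HubbardSuperconductivity.Theses.KLProgramme
import Summits.HubbardSuperconductivity.HubbardSuperconductivity.Theorems.KLProgrammeH10RungCompactBoxTruncated
import Literature.MathematicalPhysics.QuantumLattice.HubbardTruncatedCoeffThermodynamicLimit
import Literature.MathematicalPhysics.QuantumLattice.HubbardTruncatedCoeffCauchy
import Literature.MathematicalPhysics.QuantumLattice.HubbardBetaUBound
import Literature.MathematicalPhysics.QuantumLattice.HubbardThermalTwoPointMatsubaraLimit
import Literature.MathematicalPhysics.QuantumLattice.TorusCooperSum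
import Literature.Analysis.Complex.Montel
import HarnessLib

/-!
# Rung R0 `H10RungBetaUCorner` (stmt-HubbardSuperconductivity-20035) of route KLProgramme, crux K1

Seat gate-hubbard-kl-p5 g3; architecture R0-SCOPE-4 (ARCH-γ).  CORE (`R0_core`): for `β ≥ β₀` and `μ ∈ [-1, -0.15]` the real
finite-volume two-point function `U ↦ ⟨c†_{xσ}c_{yσ'}⟩_{β,L,U,μ}` has, for all large `L`, an analytic extension to the disc
`|U| < κ/β` bounded uniformly on the circle.  It is obtained from the finite-`M` Grassmann representation at COMPLEX coupling
(`HubbardComplexCouplingRatio.hubbardRatio`): bounded by `Mb` on `|u| ≤ κ_U/β` uniformly in `M` (`HubbardBetaUBound`, the multiscale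
flow with Hartree-shifted complex chemical potential), convergent for small real `U` as `M → ∞` to the thermal two-point function minus
`½δ` (`HubbardThermalTwoPointMatsubaraLimit`), hence (Montel) a subsequence converges locally uniformly to a bounded holomorphic `G₀`
agreeing with the thermal function at small real `U`.  The composition CORE ⇒ hypothesis (A) (`truncatedCoeff_bound_of_extension`) ⇒
the limit for `β ≥ β₀` (`tendsto_hubbardThermalTwoPoint_of_truncated_bounds`, `termwise_limit_hubbardTorusTruncatedCoeff`); `β ≤ β₀` by
R0′ (`h10rung_twoPoint_limit_box`); `μ(δ) ∈ [-1, -0.15]` by `MuOfDopingWindow_holds`.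
-/

noncomputable section

-- the tree's namespace `Summit.<Summit>.<Problem>.Theorems` repeats the summit name by design (D-0017)
set_option linter.dupNamespace false

open Filter Topology Set Metric
open Literature.MathematicalPhysics.QuantumLattice Literature.Probability.LatticeModels

namespace Summit.HubbardSuperconductivity.HubbardSuperconductivity.Theorems

/-! ### Montel: a bounded holomorphic family converging on real points has a bounded holomorphic limit there -/

/-- **Subsequence limit of a uniformly bounded holomorphic family**: if `g n` are holomorphic on `|z| < R` and bounded by `B` there,
and converge at the points of a set `T` of the ball to `h`, then some holomorphic `G₀` on the ball, bounded by `B`, equals `h` on `T`. -/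
theorem exists_limit_of_bounded_family {R B : ℝ} {g : ℕ → ℂ → ℂ} (hg : ∀ n, DifferentiableOn ℂ (g n) (ball 0 R))
    (hB : ∀ n, ∀ z ∈ ball (0 : ℂ) R, ‖g n z‖ ≤ B) {T : Set ℂ} (hT : T ⊆ ball 0 R) {h : ℂ → ℂ}
    (hlim : ∀ t ∈ T, Tendsto (fun n => g n t) atTop (𝓝 (h t))) :
    ∃ G₀ : ℂ → ℂ, DifferentiableOn ℂ G₀ (ball 0 R) ∧ (∀ z ∈ ball (0 : ℂ) R, ‖G₀ z‖ ≤ B) ∧ ∀ t ∈ T, G₀ t = h t := by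
  obtain ⟨G₀, φ, hφ, hG₀, hconv, -⟩ := Complex.exists_strictMono_tendstoLocallyUniformlyOn_of_norm_le isOpen_ball hg hB
  refine ⟨G₀, hG₀, fun z hz => ?_, fun t ht => ?_⟩
  · exact le_of_tendsto' ((hconv.tendsto_at hz).norm) fun n => hB _ z hz
  · exact tendsto_nhds_unique (hconv.tendsto_at (hT ht)) ((hlim t ht).comp hφ.tendsto_atTop)

/-! ### The bridge radius -/

/-- The smallness condition of the Matsubara bridge holds for `|U| < ρ_b(β, L)`, `|μ| ≤ 1`, `|U| ≤ 1`. -/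
theorem bridge_small {L : ℕ} [NeZero L] {β μ U : ℝ} (hβ : 0 < β) (hμ : |μ| ≤ 1) (hU1 : |U| ≤ 1)
    (hU : |U| < 1 / (3 * Real.exp 1 * ((L : ℝ) ^ 2 * β) * (2 + 2 * β) ^ 2 + 1)) :
    3 * Real.exp 1 * (|U| * (L : ℝ) ^ 2 * β) *
      ((1 / (L : ℝ) ^ 2) * ∑ q : TorusSite 2 L, (2 + β * |nambuXi L (μ - U / 2) q| / 3)) ^ 2 < 1 := by
  have hL : (0 : ℝ) < L := by exact_mod_cast Nat.pos_of_ne_zero (NeZero.ne L)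
  have hterm : ∀ q : TorusSite 2 L, 2 + β * |nambuXi L (μ - U / 2) q| / 3 ≤ 2 + 2 * β := by
    intro q
    have hξ : |nambuXi L (μ - U / 2) q| ≤ 6 := by
      rw [nambuXi]
      have h1 := abs_torusBand_le L q
      have : |torusBand L q - (μ - U / 2)| ≤ |torusBand L q| + |μ - U / 2| := abs_sub _ _
      have : |μ - U / 2| ≤ |μ| + |U / 2| := abs_sub μ (U / 2)
      rw [abs_div, abs_two] at this
      push_cast at h1
      linarith
    nlinarith
  have havg : (1 / (L : ℝ) ^ 2) * ∑ q : TorusSite 2 L, (2 + β * |nambuXi L (μ - U / 2) q| / 3) ≤ 2 + 2 * β := by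
    have hs := Finset.sum_le_card_nsmul (Finset.univ : Finset (TorusSite 2 L)) _ _ fun q _ => hterm q
    rw [Finset.card_univ, nsmul_eq_mul] at hs
    have hcard : (Fintype.card (TorusSite 2 L) : ℝ) = (L : ℝ) ^ 2 := by simp [ZMod.card]
    rw [hcard] at hs
    rw [one_div, inv_mul_le_iff₀ (by positivity)]
    exact hs
  have havg0 : 0 ≤ (1 / (L : ℝ) ^ 2) * ∑ q : TorusSite 2 L, (2 + β * |nambuXi L (μ - U / 2) q| / 3) := by positivity
  have hD : 0 < 3 * Real.exp 1 * ((L : ℝ) ^ 2 * β) * (2 + 2 * β) ^ 2 := by positivity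
  calc 3 * Real.exp 1 * (|U| * (L : ℝ) ^ 2 * β) * ((1 / (L : ℝ) ^ 2) * ∑ q : TorusSite 2 L, (2 + β * |nambuXi L (μ - U / 2) q| / 3)) ^ 2
      ≤ 3 * Real.exp 1 * (|U| * (L : ℝ) ^ 2 * β) * (2 + 2 * β) ^ 2 := by gcongr
    _ = |U| * (3 * Real.exp 1 * ((L : ℝ) ^ 2 * β) * (2 + 2 * β) ^ 2) := by ring
    _ < 1 / (3 * Real.exp 1 * ((L : ℝ) ^ 2 * β) * (2 + 2 * β) ^ 2 + 1) * (3 * Real.exp 1 * ((L : ℝ) ^ 2 * β) * (2 + 2 * β) ^ 2 + 1) := by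
        exact lt_of_lt_of_le (mul_lt_mul_of_pos_right hU hD) (mul_le_mul_of_nonneg_left (by linarith) (by positivity))
    _ = 1 := by field_simp

/-! ### The Lipschitz constant of the tadpole grows like `√β` -/

/-- `tadpoleLip L d₀ β ≤ C₁ + C₃ √β` for `L ≥ β ≥ 3/d₀`, `d₀ ≤ 3`, with
`C₁ = 16/9 (1/d₀ + 10/c_d + 20/3)`, `C₃ = 16/9 · 8/(log 2 · c_d)`, `c_d = 2π√(d₀/8)`. -/
theorem tadpoleLip_le {L : ℕ} {d₀ β : ℝ} (hd₀ : 0 < d₀) (hd₀3 : d₀ ≤ 3) (hβ : 3 / d₀ ≤ β) (hL : β ≤ L) :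
    tadpoleLip L d₀ β ≤ 16 / 9 * (1 / d₀ + 10 / (2 * Real.pi * Real.sqrt (d₀ / 8)) + 20 / 3) +
      16 / 9 * (8 / (Real.log 2 * (2 * Real.pi * Real.sqrt (d₀ / 8)))) * Real.sqrt β := by
  have hβ0 : 0 < β := lt_of_lt_of_le (by positivity) hβ
  have hL0 : (0 : ℝ) < L := lt_of_lt_of_le hβ0 hL
  have hcd : 0 < 2 * Real.pi * Real.sqrt (d₀ / 8) := by positivity
  have hlog2 : 0 < Real.log 2 := Real.log_pos one_lt_two
  -- `log(d₀β/3) ≤ 2√(d₀β/3) ≤ 2√β`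
  have hx : 0 < d₀ * β / 3 := by positivity
  have hlog : Real.log (d₀ * β / 3) ≤ 2 * Real.sqrt β := by
    have h1 : Real.log (d₀ * β / 3) = 2 * Real.log (Real.sqrt (d₀ * β / 3)) := by
      rw [Real.log_sqrt hx.le]; ring
    have h2 : Real.log (Real.sqrt (d₀ * β / 3)) ≤ Real.sqrt (d₀ * β / 3) :=
      (Real.log_le_sub_one_of_pos (Real.sqrt_pos.2 hx)).trans (by linarith)
    have h3 : Real.sqrt (d₀ * β / 3) ≤ Real.sqrt β := Real.sqrt_le_sqrt (by nlinarith)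
    linarith
  have hβL : β / L ≤ 1 := by rw [div_le_one hL0]; exact hL
  unfold tadpoleLip
  have h4 : (4 * (Real.log (d₀ * β / 3) / Real.log 2 + 2) + 2) / (2 * Real.pi * Real.sqrt (d₀ / 8)) ≤
      10 / (2 * Real.pi * Real.sqrt (d₀ / 8)) + 8 / (Real.log 2 * (2 * Real.pi * Real.sqrt (d₀ / 8))) * Real.sqrt β := by
    have : 4 * (Real.log (d₀ * β / 3) / Real.log 2 + 2) + 2 ≤ 10 + 8 / Real.log 2 * Real.sqrt β := by
      have := div_le_div_of_nonneg_right hlog hlog2.le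
      rw [show 2 * Real.sqrt β / Real.log 2 = 2 / Real.log 2 * Real.sqrt β by ring] at this
      have h8 : 4 * (2 / Real.log 2 * Real.sqrt β) = 8 / Real.log 2 * Real.sqrt β := by ring
      linarith
    calc (4 * (Real.log (d₀ * β / 3) / Real.log 2 + 2) + 2) / (2 * Real.pi * Real.sqrt (d₀ / 8))
        ≤ (10 + 8 / Real.log 2 * Real.sqrt β) / (2 * Real.pi * Real.sqrt (d₀ / 8)) := div_le_div_of_nonneg_right this hcd.le
      _ = 10 / (2 * Real.pi * Real.sqrt (d₀ / 8)) + 8 / (Real.log 2 * (2 * Real.pi * Real.sqrt (d₀ / 8))) * Real.sqrt β := by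
          field_simp
  nlinarith [h4, hβL]

/-! ### CORE -/

/-- **The Matsubara cutoffs admissible at `β`**: for `β ≥ 40` all large `M` satisfy the grid conditions of the flow
(`Λ₀ = 1/40`, `N = 4M`). -/
theorem exists_M₀ {β : ℝ} (hβ : 40 ≤ β) :
    ∃ M₀ : ℕ, ∀ M : ℕ, M₀ ≤ M → 2 ≤ M ∧ (1 / 40 : ℝ) * β ≤ ((4 * M : ℕ) : ℝ) ∧ ((1 / 40 : ℝ) * β) ^ 5 ≤ (2 * (M : ℝ) - 3) ^ 2 ∧
      (1 / 40 : ℝ) < Real.pi * (2 * M - 3) / β := by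
  have hβ0 : 0 < β := by linarith
  refine ⟨⌈((1 / 40 : ℝ) * β) ^ 5⌉₊ + ⌈β⌉₊ + 2, fun M hMM => ?_⟩
  have hM2 : 2 ≤ M := by omega
  have hMr : ((⌈((1 / 40 : ℝ) * β) ^ 5⌉₊ + ⌈β⌉₊ + 2 : ℕ) : ℝ) ≤ M := by exact_mod_cast hMM
  push_cast at hMr
  have h5 : ((1 / 40 : ℝ) * β) ^ 5 ≤ ⌈((1 / 40 : ℝ) * β) ^ 5⌉₊ := Nat.le_ceil _
  have hb : β ≤ ⌈β⌉₊ := Nat.le_ceil _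
  have hΛβ : 1 ≤ (1 / 40 : ℝ) * β := by linarith
  have hpow : (1 / 40 : ℝ) * β ≤ ((1 / 40 : ℝ) * β) ^ 5 := le_self_pow₀ hΛβ (by norm_num)
  have h2M3 : ((1 / 40 : ℝ) * β) ^ 5 + β ≤ 2 * (M : ℝ) - 3 := by linarith
  refine ⟨hM2, ?_, ?_, ?_⟩
  · push_cast; linarith
  · have h1 : 1 ≤ 2 * (M : ℝ) - 3 := by linarith
    calc ((1 / 40 : ℝ) * β) ^ 5 ≤ 2 * (M : ℝ) - 3 := by linarith
      _ ≤ (2 * (M : ℝ) - 3) ^ 2 := le_self_pow₀ h1 (by norm_num)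
  · rw [lt_div_iff₀ hβ0]; nlinarith [Real.pi_gt_three]

/-- **CORE at one `(β, μ, L)`**: given the data of the flow at `β` (window `d₀ = δ = 1/20`, `Λ₀ = 1/40`), the analytic extension of the
two-point function to `|U| < κ_U/(2β)`, bounded by `Mb + ½` on the circle, equal to the thermal two-point function at small real `U`. -/
theorem R0_core_at {L : ℕ} [NeZero L] {Cuv Csl κU β μ : ℝ} {K : ℕ} (hL3 : 3 ≤ L)
    (hμ4 : (1 / 20 : ℝ) + 1 / 20 ≤ μ + 4) (hμ0 : (1 / 20 : ℝ) + 1 / 20 ≤ -μ) (hμabs : |μ| ≤ 1) (hβ1 : 1 ≤ β) (hβ3 : 3 / (1 / 20 : ℝ) ≤ β)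
    (hΛ₀β : 2 * (2 * Real.pi / β) ≤ (1 / 40 : ℝ))
    (hK : K ≠ 0) (htop : gridScale β (1 / 40) flowR K 1 ≤ 1 / 40) (hletop : (1 / 40 : ℝ) ≤ flowR * gridScale β (1 / 40) flowR K 1)
    (hbox1 : 3 / 2 * κU ≤ Real.pi / 4) (hbox2 : 3 / 2 * κU / β ≤ 1 / 20) (hLip : 3 * tadpoleLip L (1 / 20) β * κU ≤ β)
    (hLip2 : κU ^ 2 * tadpoleLip L (1 / 20) β ^ 2 ≤ Real.pi * β) (hκU0 : 0 < κU) (hL : 2 * β * Real.sqrt ((1 / 20 : ℝ) / 8) ≤ L)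
    (hCuv : 0 < Cuv) (hCsl : 0 < Csl)
    (Cuv_rows : ∀ (L' M' N' : ℕ) [NeZero L'] [NeZero N'] (β μ θ r : ℝ) (K : ℕ),
      0 < β → |β * θ| ≤ Real.pi / 4 → Real.pi / β ≤ (1 / 40 : ℝ) → 2 * (2 * Real.pi / β) ≤ (1 / 40 : ℝ) → 2 ≤ M' → 2 * M' ≤ N' →
      (1 / 40 : ℝ) * β ≤ N' → ((1 / 40 : ℝ) * β) ^ 5 ≤ (2 * (M' : ℝ) - 3) ^ 2 →
      (∀ X : GridLeg (GridPoint L' N'), ∑ Y, ‖gridScaleCov L' M' N' β μ θ (1 / 40) r K 0 X Y‖ ≤ Cuv * (N' / β)) ∧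
      (∀ Y : GridLeg (GridPoint L' N'), ∑ X, ‖gridScaleCov L' M' N' β μ θ (1 / 40) r K 0 X Y‖ ≤ Cuv * (N' / β)))
    (Csl_rows : ∀ (L' M' N' : ℕ) [NeZero L'] [NeZero N'] (β μ θ Λ₀ : ℝ) (K j : ℕ), j ≠ 0 → j ≤ K →
      0 < β → (1 / 20 : ℝ) ≤ μ + 4 → (1 / 20 : ℝ) ≤ -μ → |β * θ| ≤ Real.pi / 4 → Real.pi / β ≤ gridScale β Λ₀ flowR K j →
      gridScale β Λ₀ flowR K j ≤ 1 →
      gridScale β Λ₀ flowR K j ≤ gridScale β Λ₀ flowR K (j - 1) → gridScale β Λ₀ flowR K (j - 1) ≤ flowR * gridScale β Λ₀ flowR K j →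
      gridScale β Λ₀ flowR K (j - 1) ≤ (1 / 20 : ℝ) / 2 → gridScale β Λ₀ flowR K (j - 1) < Real.pi * (2 * M' - 3) / β → 2 * M' ≤ N' → 2 ≤ M' →
      gridScale β Λ₀ flowR K j * β ≤ N' → 2 * Real.pi * Real.sqrt ((1 / 20 : ℝ) / 8) ≤ gridScale β Λ₀ flowR K (j - 1) * L' →
      (∀ X : GridLeg (GridPoint L' N'), ∑ Y, ‖gridScaleCov L' M' N' β μ θ Λ₀ flowR K j X Y‖ ≤
          Csl * (N' / β) / (gridScale β Λ₀ flowR K j * Real.sqrt (gridScale β Λ₀ flowR K j))) ∧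
      (∀ Y : GridLeg (GridPoint L' N'), ∑ X, ‖gridScaleCov L' M' N' β μ θ Λ₀ flowR K j X Y‖ ≤
          Csl * (N' / β) / (gridScale β Λ₀ flowR K j * Real.sqrt (gridScale β Λ₀ flowR K j))))
    (small₁ : κU * (betaE4 Cuv (1 / 20) (1 / 40) + betaE2 Csl (1 / 20) / Real.sqrt Real.pi) ≤ 1 / 60)
    (small₂ : κU ^ 2 * betaE6 Cuv Csl (1 / 20) (1 / 40) ≤ 1 / 60) (x y : Site 2) (σ σ' : Fin 2) :
    ∃ (G : ℂ → ℂ) (ρ : ℝ), 0 < ρ ∧ DiffContOnCl ℂ G (ball 0 (κU / 2 / β)) ∧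
      (∀ z ∈ sphere (0 : ℂ) (κU / 2 / β), ‖G z‖ ≤ betaUMb Cuv Csl (1 / 20) (1 / 40) κU + 1 / 2) ∧
      ∀ U : ℝ, 0 < |U| → |U| < ρ → G (U : ℂ) = hubbardThermalTwoPoint β U μ L x y σ σ' := by
  have hβ0 : 0 < β := lt_of_lt_of_le one_pos hβ1
  have hd₀ : (0 : ℝ) < 1 / 20 := by norm_num
  obtain ⟨M₀, hM₀facts⟩ := exists_M₀ (β := β) (by norm_num at hβ3 ⊢; linarith)
  -- the family `g n = R_{L, M₀+n}`
  have hkey : ∀ (n : ℕ) (u : ℂ), ‖u‖ ≤ κU / β →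
      hubbardRatioDen L (M₀ + n) β μ u ≠ 0 ∧
        ‖hubbardRatio L (M₀ + n) β μ (Torus.proj L x) (Torus.proj L y) σ σ' u‖ ≤ betaUMb Cuv Csl (1 / 20) (1 / 40) κU := by
    intro n u hu
    obtain ⟨hM2, hNβ, hMβ, hMπ⟩ := hM₀facts (M₀ + n) (Nat.le_add_right _ _)
    haveI : NeZero (4 * (M₀ + n)) := ⟨by omega⟩
    exact norm_hubbardRatio_le_betaUMb (N := 4 * (M₀ + n)) hd₀ hμ4 hμ0 hβ1 hβ3 hΛ₀β (by norm_num) (by norm_num) hK htop hletop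
      hbox1 hbox2 hLip hLip2 hκU0.le hu hM2 (by omega) (by omega) hNβ hMβ hMπ hL hCuv hCsl Cuv_rows Csl_rows small₁ small₂ _ _ σ σ'
  have hdiff : ∀ n, DifferentiableOn ℂ (hubbardRatio L (M₀ + n) β μ (Torus.proj L x) (Torus.proj L y) σ σ') (ball 0 (κU / β)) :=
    fun n => differentiableOn_hubbardRatio β μ _ _ σ σ' fun u hu => (hkey n u (mem_ball_zero_iff.1 hu).le).1
  have hbd : ∀ n, ∀ z ∈ ball (0 : ℂ) (κU / β), ‖hubbardRatio L (M₀ + n) β μ (Torus.proj L x) (Torus.proj L y) σ σ' z‖ ≤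
      betaUMb Cuv Csl (1 / 20) (1 / 40) κU := fun n z hz => (hkey n z (mem_ball_zero_iff.1 hz).le).2
  -- the bridge on small real couplings
  obtain ⟨ρ, hρ0, hρκ, hρ1, hρb⟩ : ∃ ρ : ℝ, 0 < ρ ∧ ρ < κU / β ∧ ρ ≤ 1 ∧
      ρ ≤ 1 / (3 * Real.exp 1 * ((L : ℝ) ^ 2 * β) * (2 + 2 * β) ^ 2 + 1) := by
    refine ⟨min (κU / (2 * β)) (min 1 (1 / (3 * Real.exp 1 * ((L : ℝ) ^ 2 * β) * (2 + 2 * β) ^ 2 + 1))),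
      lt_min (by positivity) (lt_min one_pos (by positivity)), lt_of_le_of_lt (min_le_left _ _) ?_,
      (min_le_right _ _).trans (min_le_left _ _), (min_le_right _ _).trans (min_le_right _ _)⟩
    rw [div_lt_div_iff_of_pos_left hκU0 (by positivity) hβ0]; linarith
  set corr : ℂ := if σ = σ' ∧ Torus.proj L x = Torus.proj L y then (1 / 2 : ℂ) else 0 with hcorr
  have hTball : (fun U : ℝ => (U : ℂ)) '' {U : ℝ | 0 < |U| ∧ |U| < ρ} ⊆ ball 0 (κU / β) := by
    rintro _ ⟨U, ⟨-, hU⟩, rfl⟩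
    rw [mem_ball_zero_iff, Complex.norm_real, Real.norm_eq_abs]
    linarith
  have hlim : ∀ t ∈ (fun U : ℝ => (U : ℂ)) '' {U : ℝ | 0 < |U| ∧ |U| < ρ},
      Tendsto (fun n => hubbardRatio L (M₀ + n) β μ (Torus.proj L x) (Torus.proj L y) σ σ' t) atTop
        (𝓝 ((fun t : ℂ => hubbardThermalTwoPoint β t.re μ L x y σ σ' - corr) t)) := by
    rintro _ ⟨U, ⟨-, hU⟩, rfl⟩
    have hU1 : |U| ≤ 1 := hU.le.trans hρ1
    have hUb : |U| < 1 / (3 * Real.exp 1 * ((L : ℝ) ^ 2 * β) * (2 + 2 * β) ^ 2 + 1) := lt_of_lt_of_le hU hρb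
    have hsm := bridge_small (L := L) hβ0 hμabs hU1 hUb
    have hbr := tendsto_grassmannTwoPoint_eq_hubbardThermalTwoPoint_sub hL3 hβ0 (μ - U / 2) σ σ' x y hsm
    rw [sub_add_cancel] at hbr
    simp only [Complex.ofReal_re]
    have hfun : (fun n => hubbardRatio L (M₀ + n) β μ (Torus.proj L x) (Torus.proj L y) σ σ' (U : ℂ)) =
        (fun M : ℕ => gaussExpect ℂ (hubbardCovariance L M β (μ - U / 2) 0)
          (positionField L M β 0 σ (Torus.proj L x) 0 * positionField L M β 1 σ' (Torus.proj L y) 0 *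
            grassmannExp (-(hubbardInteraction L M β U))) /
          effPartitionFn ℂ (hubbardCovariance L M β (μ - U / 2) 0) (hubbardInteraction L M β U)) ∘ (fun n => M₀ + n) := by
      funext n; exact hubbardRatio_ofReal hβ0 μ _ _ σ σ' U
    rw [hfun]
    exact hbr.comp (tendsto_atTop_atTop.2 fun b => ⟨b, fun n hn => le_add_left hn⟩)
  obtain ⟨G₀, hG₀, hG₀b, hG₀T⟩ := exists_limit_of_bounded_family hdiff hbd hTball hlim
  have hhalf : κU / 2 / β < κU / β := by rw [div_div, div_lt_div_iff_of_pos_left hκU0 (by positivity) hβ0]; linarith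
  have hsub : closedBall (0 : ℂ) (κU / 2 / β) ⊆ ball 0 (κU / β) := fun z hz => by
    rw [mem_closedBall_zero_iff] at hz; rw [mem_ball_zero_iff]; linarith
  refine ⟨fun z => G₀ z + corr, ρ, hρ0, ?_, ?_, ?_⟩
  · refine ⟨(hG₀.mono (ball_subset_closedBall.trans hsub)).add_const _, ?_⟩
    rw [closure_ball _ (by positivity)]
    exact (hG₀.continuousOn.mono hsub).add continuousOn_const
  · intro z hz
    have hz' : z ∈ ball (0 : ℂ) (κU / β) := by rw [mem_sphere_zero_iff_norm] at hz; rw [mem_ball_zero_iff, hz]; exact hhalf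
    have hc : ‖corr‖ ≤ 1 / 2 := by rw [hcorr]; split_ifs <;> simp
    exact (norm_add_le _ _).trans (add_le_add (hG₀b z hz') hc)
  · intro U hU0 hU
    show G₀ U + corr = _
    rw [hG₀T _ ⟨U, ⟨hU0, hU⟩, rfl⟩]
    simp

/-- **CORE (R0-SCOPE-4): a volume-uniform analytic extension in the coupling** — there are `κ, β₀ > 0` such that for every
`β ≥ β₀`, every `μ ∈ [-1, -0.15]` and all sites/spins there is `M` with: for all large `L` some `G : ℂ → ℂ`, complex
differentiable on `|U| < κ/β` and continuous on the closed disc, bounded by `M` on `|U| = κ/β`, coincides with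
`U ↦ hubbardThermalTwoPoint β U μ L x y σ σ'` at all small non-zero real `U`. -/
theorem R0_core :
    ∃ κ β₀ : ℝ, 0 < κ ∧ 0 < β₀ ∧ ∀ β : ℝ, β₀ ≤ β → ∀ μ ∈ Set.Icc (-1 : ℝ) (-0.15),
      ∀ (x y : Site 2) (σ σ' : Fin 2), ∃ M : ℝ, ∀ᶠ L : ℕ in atTop,
        ∃ (G : ℂ → ℂ) (ρ : ℝ), 0 < ρ ∧ DiffContOnCl ℂ G (ball 0 (κ / β)) ∧
          (∀ z ∈ sphere (0 : ℂ) (κ / β), ‖G z‖ ≤ M) ∧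
          ∀ U : ℝ, 0 < |U| → |U| < ρ → G (U : ℂ) = hubbardThermalTwoPoint β U μ L x y σ σ' := by
  have hd₀ : (0 : ℝ) < 1 / 20 := by norm_num
  obtain ⟨Cuv, hCuv, Cuv_rows⟩ := exists_rowSum_gridScaleCov_zero (Λ₀ := (1 / 40 : ℝ)) (by norm_num) (by norm_num)
  obtain ⟨Csl, hCsl, Csl_rows⟩ := exists_rowSum_gridScaleCov_slice (d₀ := (1 / 20 : ℝ)) (r := flowR) hd₀ (one_le_two.trans two_le_flowR)
  -- nonnegativity of the flow constants
  have hA := sliceGramA_pos hd₀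
  have hκ₀ := kappaUV_pos (1 / 20 : ℝ) (1 / 40)
  have hE4 : 0 ≤ betaE4 Cuv (1 / 20) (1 / 40) := by rw [betaE4]; positivity
  have hE2 : 0 ≤ betaE2 Csl (1 / 20) := by rw [betaE2, betaE1]; positivity
  have hE6 : 0 ≤ betaE6 Cuv Csl (1 / 20) (1 / 40) := by
    rw [betaE6, betaGam0]; have := flowG_pos; have := flowR_pos; have := flowSqr_pos; positivity
  -- the Lipschitz constants `C₁ + C₃ √β`
  have hcd0 : 0 < 2 * Real.pi * Real.sqrt ((1 / 20 : ℝ) / 8) := by positivity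
  have hlog2 : 0 < Real.log 2 := Real.log_pos one_lt_two
  obtain ⟨C₁, C₃, hC₁0, hC₃0, hLipC⟩ : ∃ C₁ C₃ : ℝ, 0 < C₁ ∧ 0 < C₃ ∧ ∀ (L : ℕ) (β : ℝ), 3 / (1 / 20 : ℝ) ≤ β → β ≤ L →
      tadpoleLip L (1 / 20) β ≤ C₁ + C₃ * Real.sqrt β :=
    ⟨_, _, by positivity, by positivity, fun L β hβ hL => tadpoleLip_le (L := L) hd₀ (by norm_num) hβ hL⟩
  -- `κ_U`: below `1`, `π/6`, the two smallness thresholds and `1/(2C₃+2)`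
  obtain ⟨κU, hκU0, hκU1, hκUπ, hs1, hs2, hκC⟩ : ∃ κU : ℝ, 0 < κU ∧ κU ≤ 1 ∧ κU ≤ Real.pi / 6 ∧
      κU * (betaE4 Cuv (1 / 20) (1 / 40) + betaE2 Csl (1 / 20) / Real.sqrt Real.pi) ≤ 1 / 60 ∧
      κU ^ 2 * betaE6 Cuv Csl (1 / 20) (1 / 40) ≤ 1 / 60 ∧ κU * C₃ ≤ 1 / 2 := by
    set a : ℝ := betaE4 Cuv (1 / 20) (1 / 40) + betaE2 Csl (1 / 20) / Real.sqrt Real.pi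
    have ha : 0 ≤ a := by positivity
    set κU : ℝ := min 1 (min (Real.pi / 6) (min (1 / (60 * a + 1)) (min (1 / (60 * betaE6 Cuv Csl (1 / 20) (1 / 40) + 1)) (1 / (2 * C₃ + 2)))))
    have h1 : κU ≤ 1 := min_le_left _ _
    have h2 : κU ≤ Real.pi / 6 := (min_le_right _ _).trans (min_le_left _ _)
    have h3 : κU ≤ 1 / (60 * a + 1) := ((min_le_right _ _).trans (min_le_right _ _)).trans (min_le_left _ _)
    have h4 : κU ≤ 1 / (60 * betaE6 Cuv Csl (1 / 20) (1 / 40) + 1) :=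
      (((min_le_right _ _).trans (min_le_right _ _)).trans (min_le_right _ _)).trans (min_le_left _ _)
    have h5 : κU ≤ 1 / (2 * C₃ + 2) := (((min_le_right _ _).trans (min_le_right _ _)).trans (min_le_right _ _)).trans (min_le_right _ _)
    have h0 : 0 < κU := lt_min one_pos (lt_min (by positivity) (lt_min (by positivity) (lt_min (by positivity) (by positivity))))
    refine ⟨κU, h0, h1, h2, ?_, ?_, ?_⟩
    · rw [le_div_iff₀ (by positivity)] at h3; nlinarith
    · rw [le_div_iff₀ (by positivity)] at h4; nlinarith
    · rw [le_div_iff₀ (by positivity)] at h5; nlinarith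
  -- `β₀`
  refine ⟨κU / 2, 160 * Real.pi + 6 * C₁ + 4 * C₁ ^ 2 + 100, by positivity, by positivity, fun β hβ μ hμ x y σ σ' => ?_⟩
  have hπ := Real.pi_gt_three
  have hC₁sq : 0 ≤ C₁ ^ 2 := sq_nonneg _
  have hβ1 : 1 ≤ β := by linarith
  have hβ0 : 0 < β := lt_of_lt_of_le one_pos hβ1
  obtain ⟨hμ1, hμ2⟩ := hμ
  refine ⟨betaUMb Cuv Csl (1 / 20) (1 / 40) κU + 1 / 2, ?_⟩
  filter_upwards [eventually_ge_atTop (max 3 ⌈β⌉₊)] with L hLge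
  have hL3 : 3 ≤ L := le_of_max_le_left hLge
  have hLβ : β ≤ L := (Nat.le_ceil β).trans (by exact_mod_cast le_of_max_le_right hLge)
  haveI : NeZero L := ⟨by omega⟩
  have hβ60 : 3 / (1 / 20 : ℝ) ≤ β := by norm_num; linarith
  have hΛ₀β : 2 * (2 * Real.pi / β) ≤ 1 / 40 := by
    rw [show 2 * (2 * Real.pi / β) = 4 * Real.pi / β by ring, div_le_iff₀ hβ0]; linarith
  have hπβ : Real.pi / β ≤ 1 / 40 := by
    have h0 : 0 < Real.pi / β := div_pos Real.pi_pos hβ0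
    have h4 : 2 * (2 * Real.pi / β) = 4 * (Real.pi / β) := by ring
    linarith
  obtain ⟨K, hK, htop, hletop⟩ := exists_flowK hβ0 hπβ
  have hbox1 : 3 / 2 * κU ≤ Real.pi / 4 := by linarith
  have hbox2 : 3 / 2 * κU / β ≤ 1 / 20 := by rw [div_le_iff₀ hβ0]; linarith
  have hLip0 := hLipC L β hβ60 hLβ
  have hsq : Real.sqrt β ^ 2 = β := Real.sq_sqrt hβ0.le
  have h9 : 3 ≤ Real.sqrt β := by
    rw [show (3 : ℝ) = Real.sqrt (3 ^ 2) by rw [Real.sqrt_sq (by norm_num)]]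
    exact Real.sqrt_le_sqrt (by linarith)
  have hLipnn : 0 ≤ tadpoleLip L (1 / 20) β := tadpoleLip_nonneg hd₀ hβ60
  -- `κU · Lip ≤ C₁ + √β/2`
  have hκLip : κU * tadpoleLip L (1 / 20) β ≤ C₁ + Real.sqrt β / 2 := by
    calc κU * tadpoleLip L (1 / 20) β ≤ κU * (C₁ + C₃ * Real.sqrt β) := mul_le_mul_of_nonneg_left hLip0 hκU0.le
      _ = κU * C₁ + κU * C₃ * Real.sqrt β := by ring
      _ ≤ 1 * C₁ + 1 / 2 * Real.sqrt β := add_le_add (mul_le_mul_of_nonneg_right hκU1 hC₁0.le)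
          (mul_le_mul_of_nonneg_right hκC (Real.sqrt_nonneg β))
      _ = C₁ + Real.sqrt β / 2 := by ring
  have h3sq : 3 * Real.sqrt β ≤ β := by
    calc 3 * Real.sqrt β ≤ Real.sqrt β * Real.sqrt β := mul_le_mul_of_nonneg_right h9 (Real.sqrt_nonneg β)
      _ = β := Real.mul_self_sqrt hβ0.le
  have hLip : 3 * tadpoleLip L (1 / 20) β * κU ≤ β := by
    have h6 : 6 * C₁ ≤ β := by linarith
    calc 3 * tadpoleLip L (1 / 20) β * κU = 3 * (κU * tadpoleLip L (1 / 20) β) := by ring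
      _ ≤ 3 * (C₁ + Real.sqrt β / 2) := by linarith
      _ = (6 * C₁) / 2 + (3 * Real.sqrt β) / 2 := by ring
      _ ≤ β / 2 + β / 2 := by linarith
      _ = β := by ring
  have hLip2 : κU ^ 2 * tadpoleLip L (1 / 20) β ^ 2 ≤ Real.pi * β := by
    have h0 : 0 ≤ κU * tadpoleLip L (1 / 20) β := mul_nonneg hκU0.le hLipnn
    have h1 : (κU * tadpoleLip L (1 / 20) β) ^ 2 ≤ (C₁ + Real.sqrt β / 2) ^ 2 := pow_le_pow_left₀ h0 hκLip 2
    have h2 : (C₁ + Real.sqrt β / 2) ^ 2 ≤ 2 * C₁ ^ 2 + β / 2 := by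
      have hid : (C₁ + Real.sqrt β / 2) ^ 2 + (C₁ - Real.sqrt β / 2) ^ 2 = 2 * C₁ ^ 2 + Real.sqrt β ^ 2 / 2 := by ring
      have hnn : 0 ≤ (C₁ - Real.sqrt β / 2) ^ 2 := sq_nonneg _
      rw [hsq] at hid
      linarith
    have h4 : 4 * C₁ ^ 2 ≤ β := by linarith
    calc κU ^ 2 * tadpoleLip L (1 / 20) β ^ 2 = (κU * tadpoleLip L (1 / 20) β) ^ 2 := by ring
      _ ≤ 2 * C₁ ^ 2 + β / 2 := h1.trans h2
      _ ≤ β := by linarith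
      _ ≤ Real.pi * β := le_mul_of_one_le_left hβ0.le (by linarith)
  have hLd : 2 * β * Real.sqrt ((1 / 20 : ℝ) / 8) ≤ L := by
    have h1 : Real.sqrt ((1 / 20 : ℝ) / 8) ≤ 1 / 2 := by
      rw [show ((1 / 20 : ℝ) / 8) = 1 / 160 by norm_num, Real.sqrt_le_left (by norm_num)]; norm_num
    calc 2 * β * Real.sqrt ((1 / 20 : ℝ) / 8) ≤ 2 * β * (1 / 2) := mul_le_mul_of_nonneg_left h1 (by linarith)
      _ = β := by ring
      _ ≤ L := hLβ
  have hμ4 : (1 / 20 : ℝ) + 1 / 20 ≤ μ + 4 := by linarith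
  have hμ0 : (1 / 20 : ℝ) + 1 / 20 ≤ -μ := by norm_num at hμ2 ⊢; linarith
  have hμabs : |μ| ≤ 1 := abs_le.2 ⟨by linarith, by norm_num at hμ2; linarith⟩
  exact R0_core_at hL3 hμ4 hμ0 hμabs hβ1 hβ60 hΛ₀β hK htop hletop hbox1 hbox2 hLip hLip2 hκU0 hLd hCuv hCsl Cuv_rows Csl_rows hs1 hs2
    x y σ σ'

/-- **Hypothesis (A) at radius `κ/β` from CORE**: `‖t_j(L)‖ ≤ M/(κ/β)^j` for all large `L`. -/
theorem R0_truncatedCoeff_geometric :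
    ∃ κ β₀ : ℝ, 0 < κ ∧ 0 < β₀ ∧ ∀ β : ℝ, β₀ ≤ β → ∀ μ ∈ Set.Icc (-1 : ℝ) (-0.15),
      ∀ (x y : Site 2) (σ σ' : Fin 2), ∃ M : ℝ, ∀ᶠ L : ℕ in atTop, ∀ j : ℕ,
        ‖hubbardTorusTruncatedCoeff β μ L x y σ σ' j‖ ≤ M / (κ / β) ^ j := by
  obtain ⟨κ, β₀, hκ, hβ₀, h⟩ := R0_core
  refine ⟨κ, β₀, hκ, hβ₀, fun β hβ μ hμ x y σ σ' => ?_⟩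
  obtain ⟨M, hM⟩ := h β hβ μ hμ x y σ σ'
  have hβpos : 0 < β := lt_of_lt_of_le hβ₀ hβ
  exact ⟨M, truncatedCoeff_bound_of_extension μ x y σ σ' hβpos.le (div_pos hκ hβpos) hM⟩

/-- **R0 `H10RungBetaUCorner`** — `∃ U₀ κ' > 0`, for all `δ ∈ [0.10, 0.35]`, `0 < U ≤ U₀`, `β > 0` with `βU ≤ κ'`, the
thermodynamic limit of the two-point function exists.  Large `β ≥ β₀`: (A) at radius `κ/β > U` (since `βU ≤ κ' = κ/2`) and the
termwise limits of the tree; small `β ≤ β₀`: the compact-box engine of R0′ with `U ≤ U₀ = r₀/2 < r₀`; `μ(δ) ∈ [-1, -0.15]` by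
`MuOfDopingWindow_holds`. -/
theorem H10RungBetaUCorner_of :
    Summit.HubbardSuperconductivity.HubbardSuperconductivity.Theses.KLProgramme.H10RungBetaUCorner := by
  obtain ⟨κ, β₀, hκ, hβ₀, hA⟩ := R0_truncatedCoeff_geometric
  obtain ⟨r₀, hr₀, hbox⟩ := h10rung_twoPoint_limit_box β₀ (-1) (-0.15)
  refine ⟨r₀ / 2, κ / 2, by positivity, by positivity, ?_⟩
  intro δ hδ U β hU hUle hβ hβU x y σ σ'
  have hμ : chemicalPotentialOfDensity (squareDispersion 1 0) (1 - δ) ∈ Icc (-1 : ℝ) (-0.15) :=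
    Summit.HubbardSuperconductivity.HubbardSuperconductivity.Theses.KLProgramme.MuOfDopingWindow_holds δ hδ
  set μ := chemicalPotentialOfDensity (squareDispersion 1 0) (1 - δ) with hμdef
  rcases le_or_gt β β₀ with hle | hgt
  · -- the compact box `β ≤ β₀`: R0′'s single-scale engine
    have hUr : |U| < r₀ := by rw [abs_of_pos hU]; linarith
    exact hbox β ⟨hβ, hle⟩ μ hμ U hUr x y σ σ'
  · -- `β > β₀`: hypothesis (A) at radius `κ/β` and the termwise limits
    obtain ⟨M, hM⟩ := hA β hgt.le μ hμ x y σ σ'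
    have hr : |U| < κ / β := by
      rw [abs_of_pos hU, lt_div_iff₀ hβ]
      nlinarith
    exact ⟨_, tendsto_hubbardThermalTwoPoint_of_truncated_bounds β U μ x y σ σ' hr hM
      (termwise_limit_hubbardTorusTruncatedCoeff β μ hβ.le x y σ σ')⟩

end Summit.HubbardSuperconductivity.HubbardSuperconductivity.Theorems

end
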